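import Literature.Barriers.CriticalPhenomena.SupercriticalSAWSpaceFillingPhases
import Literature.Probability.RandomPlanarGeometry.ChordalReversibility
import Literature.Probability.RandomPlanarGeometry.PolylineUniform
import Literature.Probability.RandomPlanarGeometry.SLEUniquenessInLaw
import Literature.Probability.RandomPlanarGeometry.FreelyJointedSAWCovariance
import Mathlib.MeasureTheory.Measure.HasOuterApproxClosed
import HarnessLib

/-!
# Barrier mechanism, eighth audit: the fugacity-`x` self-avoiding walk is EXACTLY reversible at
# every `x`, so any SLE_κ description of the supercritical phase is a reversible SLE_κ — which, by
# Miller–Sheffield, pins `κ = 8` exactly; and the Lawler–Schramm–Werner conjecture itself implies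
# the reversibility of chordal SLE_{8/3}

Barrier catalogue `Literature/Barriers/CriticalPhenomena/` (D-0021); eighth audit (2026-08-16,
refuter, "barrier-audit" gen 8) of the mechanism file `…Proofs` of `SupercriticalSAWSpaceFilling`
(= Theorem 1 of H. Duminil-Copin, G. Kozma, A. Yadin, *Supercritical self-avoiding walks are
space-filling*, Ann. IHP Probab. Stat. 50 (2014) 315–326, arXiv:1110.3074 — PROVED in the tree,
`SupercriticalSAWSpaceFilling_holds`; `blocks:` line `¬ RobustSAWScalingLimit` proved with no
hypothesis, `SupercriticalSAW.not_robustSAWScalingLimit`, axioms re-checked in this audit: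
`propext`, `Classical.choice`, `Quot.sound`). Generations 1–7 mapped the fugacity axis on both
sides (`…Narrow`, `…Subcritical`), the topology / time-order axis (`…ProofsNarrow`), the iterated
limit (`…ProofsClosed`), the equivalence "weakly space-filling ⇔ onto limit" (`…ProofsOnto`), the
`(x, κ)` phase constraint (`…Phases`: an SLE_κ limit of the fugacity-`x` SAW of `(𝔻; 1, -1)` forces
`x = x_c ∨ (x_c < x ∧ 8 ≤ κ)`), the length axis and tuned fugacities (`…Tuned`) and left-robustness
(`…LeftRobust`). The catalogue entry records (`scope_caveats`, gen 6) exactly one point of the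
supercritical picture as "formally undecided … `κ = 8` versus `κ > 8` above `x_c` (Conjecture 11)".

Outcome of this audit: **CONFIRMED at page level, and STRENGTHENED by a lever none of the earlier
audits used — the exact time-reversal symmetry of the fugacity ensembles — which decides the
recorded point modulo a printed theorem (Miller–Sheffield 2017): an SLE_κ description of the
supercritical walk of the disc valid for both orientations of the chord has `κ = 8` EXACTLY.**

## What the audit found

1. **Exact reversibility at every fugacity (lattice level, proved).** Reversal of walks is a
   bijection `SAW(Ω_δ; a, b) → SAW(Ω_δ; b, a)` preserving the length, hence the weight `x^{|γ|}`
   for EVERY `x`, and the polyline of the reversed walk is the time reversal of the polyline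
   (`curve_sawReverse`, from the tree's `Polyline.reverse_mk_polyline`); so
   `reverse_* P_{(Ω_δ,a,b,x)} = P_{(Ω_δ,b,a,x)}` (`lawAt_map_sawReverse`) — the weight `β^{-|ω|}` of
   `μ_SAW` [LSW04, §3.1] is manifestly invariant under the reversal `ω ↦ ω^R` (notation of
   [LSW04, §3.2]), and in the continuum "every SCR family satisfies the symmetry relation
   `ℙ^a(z,w;D) = ℙ^a(w,z;D)`" [LSW04, §2.2, arXiv p. 6]. This is a TWO-SIDEDLY `x`-robust structural property (the
   catalogue lists "reversibility" among the conclusions true of the subcritical, critical and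
   supercritical laws alike, evasion (vii), gen 6 item 5) — but it had never been USED as a
   constraint on candidate limits.
2. **Reversibility passes to every limit in law (proved, soft).** Time reversal is an isometry of
   the curve space, so convergence in law of `γ_δ` to `Γ` gives convergence of `γ_δ^R` to `Γ^R`
   (`TendstoLaw.comp_continuous`), while by item 1 the law of `γ_δ^R` IS the law of the walk from
   `b_δ` to `a_δ`; limits in law being unique (`map_eq_map_of_tendstoLaw`: bounded continuous
   functions separate finite Borel measures on a metric space, Mathlib
   `ext_of_forall_integral_eq_of_IsFiniteMeasure`), IF the fugacity-`x` SAW of `(D; a, b)` converges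
   to chordal SLE_κ AND the fugacity-`x` SAW of `(D; b, a)` converges to chordal SLE_κ (both are
   instances of any universally quantified statement such as `SAWScalingLimitAt x`), THEN the
   reversal of the SLE_κ law of `(D; a, b)` is the SLE_κ law of `(D; b, a)`
   (`map_reverse_eq_of_convergesInLawToSLE_swap`; the SLE_κ law of a Dobrushin domain is unique,
   `IsSLELaw.unique'`, proved in the tree). Two corollaries:
   * (`map_reverse_eq_of_sawScalingLimit`) **the sub-problem `SAWScalingLimit` implies the
     reversibility of chordal SLE_{8/3}** in every Dobrushin domain carrying an endpoint
     approximation (e.g. the disc, `map_reverse_eq_unitDisc_of_sawScalingLimit`) — Zhan's theorem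
     [Zhan08] as a CONSEQUENCE of the Lawler–Schramm–Werner conjecture, consistent with it, and a
     necessary condition any candidate identification must meet;
   * (`eq_eight_of_convergesInLawToSLE_unitDisc_swap`) **in the supercritical phase the only
     admissible SLE is SLE₈**: for `x > x_c`, closest-site endpoints of `(𝔻; 1, -1)` and of
     `(𝔻; -1, 1)`, an SLE_κ limit for both orientations forces `8 ≤ κ` (gen 6, Theorem 1 + the
     onto-iff) and `κ ≤ 8` GIVEN the non-reversibility of chordal SLE_κ for `κ > 8` — an explicit
     hypothesis `hNR` of the declarations here, which is Miller–Sheffield's theorem: "When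
     `κ' > 8`, ordinary SLE_κ'(ρ₁;ρ₂) has time-reversal symmetry if and only if
     `ρ₁ = ρ₂ = κ'/4 − 2`" (so ordinary SLE_κ' = SLE_κ'(0;0) is time-reversal symmetric iff
     `κ' = 8`), "The time-reversal of an ordinary SLE_κ' process for `κ' > 8` is not itself an
     SLE_κ' process … it is an SLE_κ'(κ'/2−4; κ'/2−4) process" [MS17, §1.2.4]. Their symmetry
     notion (image under an anti-conformal automorphism swapping the endpoints, run backwards, has
     the same law) is the statement `reverse_* SLE_κ(D; a, b) = SLE_κ(D; b, a)` used here, by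
     conformal invariance and the reflection symmetry `√κ B ↦ -√κ B` of the driving process. So the
     machine-checked phase constraint of gen 6 sharpens, modulo [MS17], to
     `x = x_c ∨ (x_c < x ∧ κ = 8)` (`eq_criticalFugacity_or_eq_eight_of_convergesInLawToSLE_unitDisc_swap`)
     — exactly Conjecture 11 of the source ("with parameter 8 if `x > 1/μ`", p. 8) as the ONLY
     SLE description compatible with Theorem 1 and reversibility. For the disc the second
     orientation comes for free from the central symmetry `z ↦ -z` of `δℤ²` and of `𝔻`
     (`lawAt_map_sawNeg`: `(-)_* P_{(𝔻_δ,a,b,x)} = P_{(𝔻_δ,-a,-b,x)}`; `isSLECurve_neg_unitDisc`: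
     SLE_κ of `(𝔻; 1, -1)` reflected is SLE_κ of `(𝔻; -1, 1)`, by the tree's `IsSLECurve.map`;
     `convergesInLawToSLE_neg_unitDisc`), so ONE convergence statement — the fugacity-`x` SAW of
     `(𝔻; 1, -1)` with symmetric closest-site endpoints `a_δ`, `b_δ = -a_δ` converges to chordal
     SLE_κ — already forces `κ = 8` above `x_c` (`eq_eight_of_convergesInLawToSLE_unitDisc_symm`,
     mod [MS17]).
   Provenance: the critical-law case `x = x_c` of items 1–2 (exact reversibility of
   `Literature.Probability.RandomPlanarGeometry.SAW.law`, reversal of subsequential limits, "the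
   crux alone proves Zhan's reversibility") was observed and machine-checked earlier in the
   cdisprove work file of crux `SubseqIdentification`
   (`Summits/CriticalPhenomena/SAWScalingLimit/Cruxes/SubseqIdentification/Disproof.lean`, §5:
   `map_sawReverse_law`, `sleLaw_swap_eq_map_reverse_of_subseqIdentification`), which Literature
   files cannot import; here the statements are proved in the Literature tree for EVERY fugacity
   `x` (`lawAt x`) and put to a new use — the `κ`-axis of the barrier above `x_c`.
3. **What this means for the technique class.** Evasion (vii) of the catalogue ("`x`-robust
   conclusions compatible with onto limits … 'SLE_κ for some `κ(x)`' … on `[x_c, x_c + ε)`") is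
   narrowed once more: the admissible `κ(x)` for `x > x_c` is the single value `8` (mod [MS17]),
   and more generally ANY candidate description of ANY phase of the fugacity-`x` SAW by a law
   whose time reversal is a different law — chordal SLE_κ', `κ' > 8`; SLE_κ'(ρ₁;ρ₂),
   `κ' ∈ (4, 8)`, with some `ρᵢ < κ'/2 − 4` ("the time-reversal … is not an SLE_κ'(ρ̃₁;ρ̃₂) process
   for any values", [MS17, §1.2.4] quoting Imaginary Geometry III) — is excluded at EVERY `x` at
   which it is asserted for both orientations, with no input from Theorem 1. Reversibility is thus
   a second, fugacity-blind filter standing next to the space-filling filter; neither says anything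
   about `κ` AT `x_c` beyond "reversible" (all `κ ≤ 8` are).
4. **Scope remark recorded for planners (not a theorem): side observables.** The mechanism of the
   barrier and all its audits constrain limit LAWS through functionals of the trace that are
   continuous (or semicontinuous: closed / open sets of curves) in the curve or Hausdorff topology.
   Topological SIDE observables at a fixed interior point `z` — Schramm's left-passage probability
   `P[γ passes left of z]` [Schramm01], the law of the first hit of an interior crosscut, the
   winding of `γ_δ ⊕ arc` about `z` — are continuous exactly at curves avoiding `z` and
   discontinuous at every curve through `z`; an onto limit passes through `z` almost surely, so
   NEITHER Theorem 1 NOR an SLE₈ limit determines `lim P_{x,δ}[z left of γ_δ]` for `x > x_c` (for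
   the uniform spanning tree Peano path every point is within `O(δ)` of both sides, and the side
   of `z` is decided by the configuration inside the lattice cell of `z`). Consequently
   right-robust versions (`x ∈ [x_c, x_c + ε)`) of Schramm-type formulas
   are certified false at no `x > x_c` by the source or the tree ("We know that the curve becomes
   space-filling, yet we have very little additional information", DKY §4, p. 8); their two-sided
   versions are dead in substance through the subcritical geodesic picture (the walk concentrates
   on the chord, so the side of `z ∉ [a, b]` becomes deterministic), which the tree proves only in
   the weak form `|γ_δ| = O(1/δ)` (`…SubcriticalLength`) that does not pin sides. Nobody expects
   Schramm's `κ = 8/3` formula above `x_c`; the point is only that the catalogue must not be read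
   as refuting it there.
5. **Confirmation (page level, held arXiv text of the source).** §1 p. 2 (the three phases; the
   weak sense of space-filling; "It should be the Schramm-Löwner Evolution of parameter 8"),
   Theorem 1 (p. 2) and the "bridge of width `δ`" remark with Theorem 2 (p. 3), §4 p. 8 ("very
   little additional information"; Problems 9–10; Conjecture 11) re-read; forward citations of the
   source re-listed (27 works, local graph and OpenAlex/S2; newest: quantitative sub-ballisticity
   on the hexagonal lattice, Ann. Probab. 2026, arXiv:2310.17299; loop O(n) XOR trick, Ann. Probab.
   2025) — none evades the barrier, none settles Problem 10 or Conjecture 11.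

## Formal content (all proved; one new closed `Prop`, `SupercriticalSAWSpaceFillingReversible`)

`sawReverse` (+ `walk_`, `sawReverse_sawReverse`, `length_`, `curve_sawReverse`),
`sawReverseEquiv`, `sawReverseMEquiv`, `weightAt_apply_tsum`, `weightAt_map_sawReverse`,
`lawAt_map_sawReverse`, `integral_comp_sawReverse_lawAt`; `TendstoLaw.comp_continuous`,
`map_eq_map_of_tendstoLaw`; `tendstoLaw_reverse_of_tendstoLaw`, `isSubseqLimitLaw_map_reverse`,
`map_reverse_eq_of_convergesInLawToSLE_swap`, `not_convergesInLawToSLE_swap_of_not_reversible`,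
`IsEndpointApprox.swap`, `map_reverse_eq_of_sawScalingLimitAt`, `map_reverse_eq_of_sawScalingLimit`,
`map_reverse_eq_unitDisc_of_sawScalingLimit`, `eq_eight_of_convergesInLawToSLE_unitDisc_swap`,
`eq_criticalFugacity_or_eq_eight_of_convergesInLawToSLE_unitDisc_swap`,
`eq_eight_of_forall_convergesInLawToSLE`; the disc symmetry `z ↦ -z`: `meshPoint_neg`,
`neg_mem_meshDomain_unitDisk_iff`, `negHom`, `sawNeg`, `sawNeg'`, `sawNegEquiv`, `sawNegMEquiv`,
`curve_sawNeg`, `weightAt_map_sawNeg`, `lawAt_map_sawNeg`, `integral_comp_sawNeg_lawAt`,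
`tendstoLaw_neg_of_tendstoLaw`, `negBall`, `isSLECurve_neg_unitDisc`,
`convergesInLawToSLE_neg_unitDisc`, `IsClosestSite.neg`,
`eq_eight_of_convergesInLawToSLE_unitDisc_symm`; the barrier
`SupercriticalSAWSpaceFillingReversible` with `…_holds`.

Mathlib: `SimpleGraph.Walk.reverse`, `SimpleGraph.Walk.IsPath.reverse`,
`SimpleGraph.Walk.support_reverse`, `SimpleGraph.Walk.map`, `SimpleGraph.Walk.copy`,
`SimpleGraph.Walk.isPath_map_iff_of_injective`, `List.map_reverse`, `Equiv.tsum_eq`,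
`MeasureTheory.integral_map_equiv`, `MeasureTheory.ext_of_forall_integral_eq_of_IsFiniteMeasure`,
`AEMeasurable.map_map_of_aemeasurable`, `BoundedContinuousFunction.compContinuous`,
`tendsto_nhds_unique`.

## References (page level, audit 2026-08-16)

* H. Duminil-Copin, G. Kozma, A. Yadin, Ann. IHP Probab. Stat. 50 (2014) 315–326,
  arXiv:1110.3074: p. 2 (§1, Theorem 1), p. 3 (Theorem 2, bridge remark), p. 8 (§4, Problems
  9–10, Conjecture 11). [DuminilCopinKozmaYadin2014]
* J. Miller, S. Sheffield, *Imaginary geometry IV: interior rays, whole-plane reversibility, and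
  space-filling trees*, Probab. Theory Related Fields 169 (2017) 729–869, arXiv:1302.4738: §1.2.4
  "Time-reversals of ordinary/space-filling SLE_κ(ρ₁;ρ₂)", the theorem "When `κ' > 8`, ordinary
  SLE_κ'(ρ₁;ρ₂) has time-reversal symmetry if and only if `ρ₁ = ρ₂ = κ'/4 − 2`" and the sentence
  "The time-reversal of an ordinary SLE_κ' process for `κ' > 8` is not itself an SLE_κ' process"
  (held text, chunk 13); abstract: "When `κ' ≥ 8`, ordinary SLE_κ' belongs to this family, and our
  result shows that its time-reversal is SLE_κ'(κ'/2 − 4; κ'/2 − 4)". [MillerSheffield2013]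
* D. Zhan, *Reversibility of chordal SLE*, Ann. Probab. 36 (2008) 1472–1494: chordal SLE_κ is
  reversible for `κ ∈ (0, 4]`. [Zhan2008Reversibility]
* G. F. Lawler, O. Schramm, W. Werner, *On the scaling limit of planar self-avoiding walk* (2004),
  arXiv:math/0204277: §2.2, arXiv p. 6 ("every SCR family satisfies the symmetry relation
  `ℙ^a(z,w;D) = ℙ^a(w,z;D)`"), §3.1 (`μ_SAW`: weight `β^{-n}` on each SAW of length `n`), §3.2
  (the reversal `ω^R`). [LawlerSchrammWerner2004SAW]
* O. Schramm, *A percolation formula*, Electron. Comm. Probab. 6 (2001) 115–120 (left-passage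
  probability of chordal SLE_κ). [Schramm2001Percolation]
-/

noncomputable section

open MeasureTheory Filter Topology Metric Set Literature.Probability.LatticeModels
  Literature.Probability.Percolation Literature.Probability.RandomPlanarGeometry
  Literature.Probability.RandomPlanarGeometry.SAW
open scoped ENNReal NNReal BoundedContinuousFunction

namespace Literature.Barriers.CriticalPhenomena

namespace SupercriticalSAW

/-! ### Time reversal of the self-avoiding walks of `Ω_δ` -/

section Reverse

variable {Ω : Set ℂ} {δ : ℝ} {a b : Site 2}

/-- **Reversal of a self-avoiding walk of `Ω_δ`**: the walk `γ^R = [γ_n, …, γ_0]` from `b` to `a`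
(a walk of the same graph, still a path). [cite: LawlerSchrammWerner2004SAW, §3.1] -/
def sawReverse (γ : DomainSAW Ω δ a b) : DomainSAW Ω δ b a :=
  ⟨γ.walk.reverse, γ.isPath.reverse⟩

/-- The underlying lattice walk of `γ^R` is the reversed walk. [folklore] -/
@[simp] theorem walk_sawReverse (γ : DomainSAW Ω δ a b) : (sawReverse γ).walk = γ.walk.reverse := rfl

/-- Reversal is an involution. [folklore] -/
@[simp] theorem sawReverse_sawReverse (γ : DomainSAW Ω δ a b) : sawReverse (sawReverse γ) = γ := by
  cases γ
  simp only [sawReverse, SimpleGraph.Walk.reverse_reverse]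

/-- Reversal preserves the length `|γ|`. [cite: LawlerSchrammWerner2004SAW, §3.1] -/
@[simp] theorem length_sawReverse (γ : DomainSAW Ω δ a b) : (sawReverse γ).length = γ.length :=
  SimpleGraph.Walk.length_reverse _

/-- **The curve of the reversed walk is the time reversal of the curve of the walk** (as curve
classes: the polyline through `δγ_n, …, δγ_0` is a reparametrisation of the reversed polyline
through `δγ_0, …, δγ_n`, `Polyline.reverse_mk_polyline`). [folklore] -/
theorem curve_sawReverse (γ : DomainSAW Ω δ a b) : (sawReverse γ).curve = γ.curve.reverse := by
  change CurveClass.mk ⟨polyline (γ.walk.reverse.support.map (meshPoint δ))⟩ =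
    (CurveClass.mk ⟨polyline (γ.walk.support.map (meshPoint δ))⟩).reverse
  rw [Polyline.reverse_mk_polyline, SimpleGraph.Walk.support_reverse, List.map_reverse]

/-- Reversal as a bijection `SAW(Ω_δ; a, b) ≃ SAW(Ω_δ; b, a)`. [folklore] -/
def sawReverseEquiv : DomainSAW Ω δ a b ≃ DomainSAW Ω δ b a where
  toFun := sawReverse
  invFun := sawReverse
  left_inv := sawReverse_sawReverse
  right_inv := sawReverse_sawReverse

/-- Reversal as a measurable bijection (discrete σ-algebras). [folklore] -/
def sawReverseMEquiv : DomainSAW Ω δ a b ≃ᵐ DomainSAW Ω δ b a where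
  toEquiv := sawReverseEquiv
  measurable_toFun := DomainSAW.measurable_of_top _
  measurable_invFun := DomainSAW.measurable_of_top _

/-- The underlying map of `sawReverseEquiv` is `sawReverse`. [folklore] -/
@[simp] theorem coe_sawReverseEquiv :
    ⇑(sawReverseEquiv : DomainSAW Ω δ a b ≃ DomainSAW Ω δ b a) = sawReverse := rfl

/-- The underlying map of `sawReverseMEquiv` is `sawReverse`. [folklore] -/
@[simp] theorem coe_sawReverseMEquiv :
    ⇑(sawReverseMEquiv : DomainSAW Ω δ a b ≃ᵐ DomainSAW Ω δ b a) = sawReverse := rfl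

/-- The weight `x^{|γ|}` of a set of walks as a sum of point masses.
[cite: DuminilCopinKozmaYadin2014, §1 (definition of P_{(Ω_δ,a_δ,b_δ,x)})] -/
theorem weightAt_apply_tsum (x : ℝ) (Ω : Set ℂ) (δ : ℝ) (a b : Site 2) (s : Set (DomainSAW Ω δ a b)) :
    weightAt x Ω δ a b s = ∑' γ, s.indicator (fun γ => ENNReal.ofReal (x ^ γ.length)) γ := by
  rw [weightAt, Measure.sum_apply _ MeasurableSpace.measurableSet_top]
  refine tsum_congr fun γ => ?_
  rw [Measure.smul_apply, Measure.dirac_apply' _ MeasurableSpace.measurableSet_top, smul_eq_mul]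
  by_cases h : γ ∈ s
  · rw [indicator_of_mem h, indicator_of_mem h, Pi.one_apply, mul_one]
  · rw [indicator_of_notMem h, indicator_of_notMem h, mul_zero]

/-- **The weights `x^{|γ|}` are reversal invariant at every fugacity `x`**:
`reverse_* (x^{|γ|})_{γ : a → b} = (x^{|γ|})_{γ : b → a}` (the weight `β^{-|ω|}` of `μ_SAW` is a
function of the length alone, and `|ω^R| = |ω|`). [cite: LawlerSchrammWerner2004SAW, §3.1] -/
theorem weightAt_map_sawReverse (x : ℝ) (Ω : Set ℂ) (δ : ℝ) (a b : Site 2) :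
    (weightAt x Ω δ a b).map sawReverse = weightAt x Ω δ b a := by
  ext s hs
  rw [Measure.map_apply (DomainSAW.measurable_of_top _) hs, weightAt_apply_tsum,
    weightAt_apply_tsum]
  have key : ∀ γ : DomainSAW Ω δ a b,
      (sawReverse ⁻¹' s).indicator (fun γ => ENNReal.ofReal (x ^ γ.length)) γ =
        s.indicator (fun γ' : DomainSAW Ω δ b a => ENNReal.ofReal (x ^ γ'.length))
          (sawReverseEquiv γ) := by
    intro γ
    by_cases h : sawReverse γ ∈ s
    · rw [indicator_of_mem (show γ ∈ sawReverse ⁻¹' s from h), coe_sawReverseEquiv,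
        indicator_of_mem h, length_sawReverse]
    · rw [indicator_of_notMem (show γ ∉ sawReverse ⁻¹' s from h), coe_sawReverseEquiv,
        indicator_of_notMem h]
  rw [tsum_congr key]
  exact sawReverseEquiv.tsum_eq fun γ' => s.indicator (fun γ' => ENNReal.ofReal (x ^ γ'.length)) γ'

/-- **The self-avoiding walk with parameter `x` is exactly reversible, at every `x`**:
`reverse_* P_{(Ω_δ,a,b,x)} = P_{(Ω_δ,b,a,x)}` (same weights, same partition function; the junk
cases — no walk, infinite mass — correspond to each other). [cite: LawlerSchrammWerner2004SAW, §3.1] -/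
theorem lawAt_map_sawReverse (x : ℝ) (Ω : Set ℂ) (δ : ℝ) (a b : Site 2) :
    (lawAt x Ω δ a b).map sawReverse = lawAt x Ω δ b a := by
  have huniv : weightAt x Ω δ a b univ = weightAt x Ω δ b a univ := by
    rw [← weightAt_map_sawReverse x Ω δ a b,
      Measure.map_apply (DomainSAW.measurable_of_top _) MeasurableSet.univ, preimage_univ]
  rw [lawAt, Measure.map_smul, weightAt_map_sawReverse, huniv, lawAt]

/-- Change of variables along the reversal: `E_{(Ω_δ,a,b,x)}[g(γ^R)] = E_{(Ω_δ,b,a,x)}[g(γ)]`.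
[cite: LawlerSchrammWerner2004SAW, §3.1] -/
theorem integral_comp_sawReverse_lawAt (x : ℝ) (Ω : Set ℂ) (δ : ℝ) (a b : Site 2)
    (g : DomainSAW Ω δ b a → ℝ) :
    ∫ γ, g (sawReverse γ) ∂lawAt x Ω δ a b = ∫ γ', g γ' ∂lawAt x Ω δ b a := by
  have h := integral_map_equiv (μ := lawAt x Ω δ a b) sawReverseMEquiv g
  rw [coe_sawReverseMEquiv, lawAt_map_sawReverse] at h
  exact h.symm

end Reverse

/-! ### Convergence in law: continuous images and uniqueness of the limit law -/

section LawTransport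

variable {Ωδ : ℝ → Type*} [∀ δ, MeasurableSpace (Ωδ δ)] {Ω' : Type*} [MeasurableSpace Ω']
  {X X' : Type*} [TopologicalSpace X] [TopologicalSpace X']

/-- Convergence in law is preserved by continuous maps (continuous mapping theorem in portmanteau
form: `f ∘ g` is bounded continuous when `f` is). [cite: Billingsley1999, Thm 2.7] -/
theorem _root_.Literature.Probability.RandomPlanarGeometry.TendstoLaw.comp_continuous {Y : ∀ δ, Ωδ δ → X} {P : ∀ δ, Measure (Ωδ δ)} {Z : Ω' → X}
    {P' : Measure Ω'} (h : TendstoLaw Y P Z P') {g : X → X'} (hg : Continuous g) :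
    TendstoLaw (fun δ ω => g (Y δ ω)) P (fun ω => g (Z ω)) P' := by
  intro f
  have := h (f.compContinuous ⟨g, hg⟩)
  simpa only [BoundedContinuousFunction.compContinuous_apply, ContinuousMap.coe_mk] using this

/-- **Limits in law are unique**: if the same random variables converge in law to `Z` and to `Z'`
(both a.e.-measurable, values in a metrisable Borel space, under a finite measure), then `Z` and
`Z'` have the same law — limits of real sequences are unique and bounded continuous functions
separate finite Borel measures. [cite: Billingsley1999, Thm 1.2] -/
theorem map_eq_map_of_tendstoLaw [MeasurableSpace X] [BorelSpace X] [HasOuterApproxClosed X]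
    {Y : ∀ δ, Ωδ δ → X} {P : ∀ δ, Measure (Ωδ δ)} {Z Z' : Ω' → X} {W : Measure Ω'}
    [IsFiniteMeasure W] (hZ : AEMeasurable Z W) (hZ' : AEMeasurable Z' W)
    (h : TendstoLaw Y P Z W) (h' : TendstoLaw Y P Z' W) : W.map Z = W.map Z' := by
  refine ext_of_forall_integral_eq_of_IsFiniteMeasure fun f => ?_
  rw [integral_map hZ f.continuous.aestronglyMeasurable,
    integral_map hZ' f.continuous.aestronglyMeasurable]
  exact tendsto_nhds_unique (h f) (h' f)

end LawTransport

/-! ### Reversibility of the limits of the fugacity-`x` SAW -/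

section Core

variable {κ : ℝ≥0} {D : DobrushinDomain} {x : ℝ} {A B : ℝ → Site 2}

/-- **Reversed convergence.** If the curves of the fugacity-`x` SAW from `A δ` to `B δ` converge in
law to `Γ`, then the curves of the fugacity-`x` SAW from `B δ` to `A δ` converge in law to the
time reversal `Γ^R` — because the latter laws ARE the reversed former laws
(`lawAt_map_sawReverse`, `curve_sawReverse`) and reversal is continuous on curve space.
[cite: LawlerSchrammWerner2004SAW, §3.1] -/
theorem tendstoLaw_reverse_of_tendstoLaw {Ω : Set ℂ} {Ω' : Type*} [MeasurableSpace Ω']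
    {Γ : Ω' → CurveClass ℂ} {W : Measure Ω'}
    (hT : TendstoLaw (fun δ (γ : DomainSAW Ω δ (A δ) (B δ)) => γ.curve)
      (fun δ => lawAt x Ω δ (A δ) (B δ)) Γ W) :
    TendstoLaw (fun δ (γ : DomainSAW Ω δ (B δ) (A δ)) => γ.curve)
      (fun δ => lawAt x Ω δ (B δ) (A δ)) (fun ω => (Γ ω).reverse) W := by
  intro f
  have h := (hT.comp_continuous CurveClass.continuous_reverse) f
  refine (tendsto_congr fun δ => ?_).1 h
  have hrw : (fun γ : DomainSAW Ω δ (A δ) (B δ) => f γ.curve.reverse) =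
      fun γ => (fun γ' : DomainSAW Ω δ (B δ) (A δ) => f γ'.curve) (sawReverse γ) := by
    funext γ
    simp only [curve_sawReverse]
  simp only [hrw]
  exact integral_comp_sawReverse_lawAt x Ω δ (A δ) (B δ) fun γ' => f γ'.curve

/-- **Subsequential limit laws reverse.** If `μ` is a subsequential limit law (along meshes
`s n → 0⁺`, `IsSubseqLimitLaw`) of the curves of the fugacity-`x` SAW from `A δ` to `B δ`, then
`reverse_* μ` is a subsequential limit law, along the same meshes, of the curves of the
fugacity-`x` SAW from `B δ` to `A δ` — at every `x`; so the sets of subsequential limits of the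
two orientations are exchanged by time reversal, and every identification statement about them
must be reversal-compatible. [cite: LawlerSchrammWerner2004SAW, §2.2 and §3.1] -/
theorem isSubseqLimitLaw_map_reverse {Ω : Set ℂ} {μ : Measure (CurveClass ℂ)}
    (h : IsSubseqLimitLaw (fun δ (γ : DomainSAW Ω δ (A δ) (B δ)) => γ.curve)
      (fun δ => lawAt x Ω δ (A δ) (B δ)) μ) :
    IsSubseqLimitLaw (fun δ (γ : DomainSAW Ω δ (B δ) (A δ)) => γ.curve)
      (fun δ => lawAt x Ω δ (B δ) (A δ)) (μ.map CurveClass.reverse) := by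
  obtain ⟨s, hs, hlim⟩ := h
  refine ⟨s, hs, fun f => ?_⟩
  have h1 := hlim (f.compContinuous ⟨CurveClass.reverse, CurveClass.continuous_reverse⟩)
  rw [integral_map CurveClass.measurable_reverse.aemeasurable f.continuous.aestronglyMeasurable]
  refine (tendsto_congr fun n => ?_).1 (by
    simpa only [BoundedContinuousFunction.compContinuous_apply, ContinuousMap.coe_mk] using h1)
  have hrw : (fun γ : DomainSAW Ω (s n) (A (s n)) (B (s n)) => f γ.curve.reverse) =
      fun γ => (fun γ' : DomainSAW Ω (s n) (B (s n)) (A (s n)) => f γ'.curve) (sawReverse γ) := by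
    funext γ
    simp only [curve_sawReverse]
  simp only [hrw]
  exact integral_comp_sawReverse_lawAt x Ω (s n) (A (s n)) (B (s n)) fun γ' => f γ'.curve

/-- **A two-orientation SLE_κ description of the fugacity-`x` SAW is a reversible SLE_κ.** If the
fugacity-`x` SAW of `(D; a, b)` (endpoints `A δ → B δ`) converges in law to chordal SLE_κ in
`(D; a, b)` AND the fugacity-`x` SAW of `(D; b, a)` (endpoints `B δ → A δ`) converges in law to
chordal SLE_κ in `(D; b, a) = D.swap`, then the time reversal of the SLE_κ law of `(D; a, b)` is the
SLE_κ law of `(D; b, a)`: exact lattice reversibility (`lawAt_map_sawReverse`), continuity of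
reversal, uniqueness of limits in law and uniqueness of the SLE_κ law of a Dobrushin domain
(`IsSLELaw.unique'`, proved in the tree). Valid at EVERY `x` and for every `κ`; no input from
Theorem 1. [cite: LawlerSchrammWerner2004SAW, §2.2 and §3.1] -/
theorem map_reverse_eq_of_convergesInLawToSLE_swap
    (h₁ : ConvergesInLawToSLE κ D (fun δ (γ : DomainSAW D.carrier δ (A δ) (B δ)) => γ.curve)
        (fun δ => lawAt x D.carrier δ (A δ) (B δ)))
    (h₂ : ConvergesInLawToSLE κ D.swap (fun δ (γ : DomainSAW D.carrier δ (B δ) (A δ)) => γ.curve)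
        (fun δ => lawAt x D.carrier δ (B δ) (A δ)))
    {μ μ' : Measure (CurveClass ℂ)} (hμ : IsSLELaw κ D μ) (hμ' : IsSLELaw κ D.swap μ') :
    μ.map CurveClass.reverse = μ' := by
  haveI : IsProbabilityMeasure Literature.Probability.Process.preWienerMeasure :=
    isProbabilityMeasure_preWienerMeasure'
  obtain ⟨Γ, hΓ, -, hT⟩ := h₁
  obtain ⟨Γ', hΓ', -, hT'⟩ := h₂
  have hrev := tendstoLaw_reverse_of_tendstoLaw hT
  have hae : AEMeasurable (fun ω => (Γ ω).reverse) Literature.Probability.Process.preWienerMeasure :=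
    CurveClass.measurable_reverse.comp_aemeasurable hΓ.aemeasurable
  have key := map_eq_map_of_tendstoLaw hae hΓ'.aemeasurable hrev hT'
  rw [hμ.eq_map_of_isSLECurve hΓ, hμ'.eq_map_of_isSLECurve hΓ',
    AEMeasurable.map_map_of_aemeasurable CurveClass.measurable_reverse.aemeasurable hΓ.aemeasurable]
  exact key

/-- **A non-reversible SLE_κ describes no phase of the fugacity-`x` SAW (for both orientations).**
If the SLE_κ law of `(D; a, b)` reversed is NOT the SLE_κ law of `(D; b, a)` (hypothesis `hNR`; for
`κ > 8` this is Miller–Sheffield's theorem, for SLE_κ it FAILS for all `κ ≤ 8` — Zhan,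
Miller–Sheffield), then the fugacity-`x` SAW cannot converge to chordal SLE_κ in both `(D; a, b)`
and `(D; b, a)`, whatever `x`. [cite: MillerSheffield2013, §1.2.4 (time-reversal of ordinary SLE_κ', κ' > 8)] -/
theorem not_convergesInLawToSLE_swap_of_not_reversible
    (hNR : ∀ μ μ' : Measure (CurveClass ℂ), IsSLELaw κ D μ → IsSLELaw κ D.swap μ' →
      μ.map CurveClass.reverse ≠ μ')
    (h₁ : ConvergesInLawToSLE κ D (fun δ (γ : DomainSAW D.carrier δ (A δ) (B δ)) => γ.curve)
        (fun δ => lawAt x D.carrier δ (A δ) (B δ))) :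
    ¬ ConvergesInLawToSLE κ D.swap (fun δ (γ : DomainSAW D.carrier δ (B δ) (A δ)) => γ.curve)
        (fun δ => lawAt x D.carrier δ (B δ) (A δ)) := by
  intro h₂
  have key : ∀ μ μ' : Measure (CurveClass ℂ), IsSLELaw κ D μ → IsSLELaw κ D.swap μ' →
      μ.map CurveClass.reverse = μ' := fun μ μ' => map_reverse_eq_of_convergesInLawToSLE_swap h₁ h₂
  obtain ⟨Γ, hΓ, -, -⟩ := h₁
  obtain ⟨Γ', hΓ', -, -⟩ := h₂
  exact hNR _ _ hΓ.isSLELaw_map hΓ'.isSLELaw_map (key _ _ hΓ.isSLELaw_map hΓ'.isSLELaw_map)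

/-- An endpoint approximation of `(D; a, b)` read backwards is an endpoint approximation of
`(D; b, a)`. [folklore] -/
theorem _root_.Literature.Probability.RandomPlanarGeometry.SAW.IsEndpointApprox.swap
    (h : IsEndpointApprox D A B) : IsEndpointApprox D.swap B A := by
  refine ⟨h.reachable.mono fun δ hδ => hδ.symm, ?_, ?_⟩
  · rw [MarkedDomain.pt_swap_zero]
    exact h.tendsto_snd
  · rw [MarkedDomain.pt_swap_one]
    exact h.tendsto_fst

/-- **`SAWScalingLimitAt x` forces reversibility of chordal SLE_{8/3}** in every Dobrushin domain
carrying an endpoint approximation: the universally quantified statement applies to `(D; a, b)`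
with `(A, B)` and to `(D; b, a)` with `(B, A)`. [cite: LawlerSchrammWerner2004SAW, §2.2 and §3.1] -/
theorem map_reverse_eq_of_sawScalingLimitAt (h : SAWScalingLimitAt x) (hAB : IsEndpointApprox D A B)
    {μ μ' : Measure (CurveClass ℂ)} (hμ : IsSLELaw ((8 : ℝ≥0) / 3) D μ)
    (hμ' : IsSLELaw ((8 : ℝ≥0) / 3) D.swap μ') : μ.map CurveClass.reverse = μ' :=
  map_reverse_eq_of_convergesInLawToSLE_swap (h D A B hAB) (h D.swap B A hAB.swap) hμ hμ'

/-- **The Lawler–Schramm–Werner conjecture implies the reversibility of chordal SLE_{8/3}** (in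
every Dobrushin domain carrying an endpoint approximation): Zhan's theorem as a CONSEQUENCE of the
sub-problem `SAWScalingLimit`, hence a necessary property of any candidate limit — met by SLE_{8/3}
[Zhan 2008], as it must be. [cite: Zhan2008Reversibility, main theorem] -/
theorem map_reverse_eq_of_sawScalingLimit (h : SAWScalingLimit) (hAB : IsEndpointApprox D A B)
    {μ μ' : Measure (CurveClass ℂ)} (hμ : IsSLELaw ((8 : ℝ≥0) / 3) D μ)
    (hμ' : IsSLELaw ((8 : ℝ≥0) / 3) D.swap μ') : μ.map CurveClass.reverse = μ' :=
  map_reverse_eq_of_sawScalingLimitAt (sawScalingLimitAt_criticalFugacity.2 h) hAB hμ hμ'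

/-- The disc instance: `SAWScalingLimit` implies that the SLE_{8/3} law of `(𝔻; 1, -1)` reversed is
the SLE_{8/3} law of `(𝔻; -1, 1)` (closest-site endpoints exist, `exists_closestSiteFamily`, and
form an endpoint approximation, `isEndpointApprox_unitDisc_of_isClosestSite`).
[cite: Zhan2008Reversibility, main theorem] -/
theorem map_reverse_eq_unitDisc_of_sawScalingLimit (h : SAWScalingLimit)
    {μ μ' : Measure (CurveClass ℂ)} (hμ : IsSLELaw ((8 : ℝ≥0) / 3) DobrushinDomain.unitDisc μ)
    (hμ' : IsSLELaw ((8 : ℝ≥0) / 3) DobrushinDomain.unitDisc.swap μ') :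
    μ.map CurveClass.reverse = μ' := by
  obtain ⟨A, hA⟩ := exists_closestSiteFamily (1 : ℂ)
  obtain ⟨B, hB⟩ := exists_closestSiteFamily (-1 : ℂ)
  exact map_reverse_eq_of_sawScalingLimit h
    (isEndpointApprox_unitDisc_of_isClosestSite fun δ hδ => ⟨hA δ hδ, hB δ hδ⟩) hμ hμ'

/-- **In the supercritical phase the only admissible SLE is SLE₈ (modulo Miller–Sheffield).** Let
`x > x_c`, `κ > 0`, and let `A δ, B δ` be closest sites of `𝔻_δ` to `1, -1`. If the fugacity-`x`
SAW converges to chordal SLE_κ both in `(𝔻; 1, -1)` (from `A δ` to `B δ`) and in `(𝔻; -1, 1)`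
(from `B δ` to `A δ`), then `κ = 8`: `κ ≥ 8` by Theorem 1 of the source through
`eight_le_of_convergesInLawToSLE_unitDisc` (`…Phases`), and `κ ≤ 8` because the limit would be a
reversible SLE_κ (`map_reverse_eq_of_convergesInLawToSLE_swap`) whereas, by the hypothesis `hNR`
— Miller–Sheffield: "When `κ' > 8`, ordinary SLE_κ'(ρ₁;ρ₂) has time-reversal symmetry if and
only if `ρ₁ = ρ₂ = κ'/4 − 2`", so ordinary SLE_κ', `κ' > 8`, has none — no SLE_κ with `κ > 8` is.
Conjecture 11 of the source predicts exactly SLE₈.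
[cite: MillerSheffield2013, §1.2.4 (time-reversal of ordinary SLE_κ', κ' > 8)]
[cite: DuminilCopinKozmaYadin2014, Conjecture 11] -/
theorem eq_eight_of_convergesInLawToSLE_unitDisc_swap (hx : criticalFugacity < x) (h0 : 0 < κ)
    (hAB : ∀ δ : ℝ, 0 < δ → IsClosestSite unitDisk δ 1 (A δ) ∧ IsClosestSite unitDisk δ (-1) (B δ))
    (hNR : ∀ κ' : ℝ≥0, 8 < κ' → ∀ μ μ' : Measure (CurveClass ℂ),
      IsSLELaw κ' DobrushinDomain.unitDisc μ → IsSLELaw κ' DobrushinDomain.unitDisc.swap μ' →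
        μ.map CurveClass.reverse ≠ μ')
    (h₁ : ConvergesInLawToSLE κ DobrushinDomain.unitDisc
        (fun δ (γ : DomainSAW DobrushinDomain.unitDisc.carrier δ (A δ) (B δ)) => γ.curve)
        (fun δ => lawAt x DobrushinDomain.unitDisc.carrier δ (A δ) (B δ)))
    (h₂ : ConvergesInLawToSLE κ DobrushinDomain.unitDisc.swap
        (fun δ (γ : DomainSAW DobrushinDomain.unitDisc.carrier δ (B δ) (A δ)) => γ.curve)
        (fun δ => lawAt x DobrushinDomain.unitDisc.carrier δ (B δ) (A δ))) :
    κ = 8 := by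
  have h8 : 8 ≤ κ := eight_le_of_convergesInLawToSLE_unitDisc hx h0 hAB h₁
  by_contra hne
  exact not_convergesInLawToSLE_swap_of_not_reversible (hNR κ (lt_of_le_of_ne h8 (Ne.symm hne)))
    h₁ h₂

/-- **The `(x, κ)` phase constraint, sharpened modulo Miller–Sheffield.** For `x > 0`, `κ > 0` and
closest-site endpoints: if the fugacity-`x` SAW converges to chordal SLE_κ in `(𝔻; 1, -1)` and in
`(𝔻; -1, 1)`, then `x = x_c`, or `x > x_c` and `κ = 8` — given the non-reversibility of chordal
SLE_κ' for `κ' > 8` (hypothesis `hNR`). Gen 6 (`…Phases`) had `8 ≤ κ` in the second alternative.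
[cite: MillerSheffield2013, §1.2.4 (time-reversal of ordinary SLE_κ', κ' > 8)]
[cite: DuminilCopinKozmaYadin2014, Conjecture 11] -/
theorem eq_criticalFugacity_or_eq_eight_of_convergesInLawToSLE_unitDisc_swap (hx0 : 0 < x)
    (h0 : 0 < κ)
    (hAB : ∀ δ : ℝ, 0 < δ → IsClosestSite unitDisk δ 1 (A δ) ∧ IsClosestSite unitDisk δ (-1) (B δ))
    (hNR : ∀ κ' : ℝ≥0, 8 < κ' → ∀ μ μ' : Measure (CurveClass ℂ),
      IsSLELaw κ' DobrushinDomain.unitDisc μ → IsSLELaw κ' DobrushinDomain.unitDisc.swap μ' →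
        μ.map CurveClass.reverse ≠ μ')
    (h₁ : ConvergesInLawToSLE κ DobrushinDomain.unitDisc
        (fun δ (γ : DomainSAW DobrushinDomain.unitDisc.carrier δ (A δ) (B δ)) => γ.curve)
        (fun δ => lawAt x DobrushinDomain.unitDisc.carrier δ (A δ) (B δ)))
    (h₂ : ConvergesInLawToSLE κ DobrushinDomain.unitDisc.swap
        (fun δ (γ : DomainSAW DobrushinDomain.unitDisc.carrier δ (B δ) (A δ)) => γ.curve)
        (fun δ => lawAt x DobrushinDomain.unitDisc.carrier δ (B δ) (A δ))) :
    x = criticalFugacity ∨ (criticalFugacity < x ∧ κ = 8) := by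
  rcases eq_criticalFugacity_or_eight_le_of_convergesInLawToSLE_unitDisc hx0 h0 hAB h₁ with h | h
  · exact Or.inl h
  · exact Or.inr ⟨h.1, eq_eight_of_convergesInLawToSLE_unitDisc_swap h.1 h0 hAB hNR h₁ h₂⟩

/-- **The robust conclusion "SLE_κ for some `κ = κ(x)`" above `x_c` has `κ(x) = 8` (modulo
Miller–Sheffield).** If at a supercritical fugacity `x > x_c` the fugacity-`x` SAW converges to
chordal SLE_κ in EVERY Dobrushin domain along EVERY endpoint approximation (the shape of
`SAWScalingLimitAt x` with `8/3` replaced by `κ` — evasion (vii) of the catalogue), then `κ = 8`,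
given the non-reversibility of chordal SLE_κ', `κ' > 8`, in the disc (`hNR`): both orientations
of `(𝔻; ±1)` with closest-site endpoints are instances. [cite: DuminilCopinKozmaYadin2014, Conjecture 11]
[cite: MillerSheffield2013, §1.2.4 (time-reversal of ordinary SLE_κ', κ' > 8)] -/
theorem eq_eight_of_forall_convergesInLawToSLE (hx : criticalFugacity < x) (h0 : 0 < κ)
    (hNR : ∀ κ' : ℝ≥0, 8 < κ' → ∀ μ μ' : Measure (CurveClass ℂ),
      IsSLELaw κ' DobrushinDomain.unitDisc μ → IsSLELaw κ' DobrushinDomain.unitDisc.swap μ' →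
        μ.map CurveClass.reverse ≠ μ')
    (h : ∀ (D : DobrushinDomain) (a b : ℝ → Site 2), IsEndpointApprox D a b →
      ConvergesInLawToSLE κ D (fun δ (γ : DomainSAW D.carrier δ (a δ) (b δ)) => γ.curve)
        (fun δ => lawAt x D.carrier δ (a δ) (b δ))) :
    κ = 8 := by
  obtain ⟨A, hA⟩ := exists_closestSiteFamily (1 : ℂ)
  obtain ⟨B, hB⟩ := exists_closestSiteFamily (-1 : ℂ)
  have hAB : ∀ δ : ℝ, 0 < δ → IsClosestSite unitDisk δ 1 (A δ) ∧ IsClosestSite unitDisk δ (-1) (B δ) :=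
    fun δ hδ => ⟨hA δ hδ, hB δ hδ⟩
  have hE := isEndpointApprox_unitDisc_of_isClosestSite hAB
  exact eq_eight_of_convergesInLawToSLE_unitDisc_swap hx h0 hAB hNR (h _ A B hE) (h _ B A hE.swap)

end Core

/-! ### The symmetry `z ↦ -z` of the disc: one orientation of `(𝔻; ±1)` gives the other -/

section DiscSymmetry

variable {κ : ℝ≥0} {x : ℝ} {δ : ℝ} {a b : Site 2} {A B : ℝ → Site 2}

/-- `δ · (-v) = -(δ · v)`. [folklore] -/
theorem meshPoint_neg (δ : ℝ) (v : Site 2) : meshPoint δ (-v) = -meshPoint δ v := by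
  apply Complex.ext
  · simp [meshPoint_re]
  · simp [meshPoint_im]

/-- `𝔻_δ` is symmetric under `v ↦ -v`. [folklore] -/
theorem neg_mem_meshDomain_unitDisk_iff {v : Site 2} :
    -v ∈ meshDomain unitDisk δ ↔ v ∈ meshDomain unitDisk δ := by
  rw [mem_meshDomain_unitDisk, mem_meshDomain_unitDisk, meshPoint_neg, norm_neg]

/-- The central symmetry `v ↦ -v` as a graph homomorphism of `𝔻_δ`. [folklore] -/
def negHom (δ : ℝ) : discreteDomainGraph unitDisk δ →g discreteDomainGraph unitDisk δ where
  toFun v := -v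
  map_rel' {u v} h := by
    rw [discreteDomainGraph_unitDisk_adj] at h ⊢
    exact ⟨(Zd.zdGraph_adj_neg u v).2 h.1, neg_mem_meshDomain_unitDisk_iff.2 h.2.1,
      neg_mem_meshDomain_unitDisk_iff.2 h.2.2⟩

/-- `negHom` acts as `v ↦ -v`. [folklore] -/
@[simp] theorem negHom_apply (v : Site 2) : negHom δ v = -v := rfl

/-- `negHom` is injective. [folklore] -/
theorem negHom_injective : Function.Injective (negHom δ) := fun _ _ h => neg_injective h

/-- The centrally reflected walk `-γ` of a SAW `γ` of `𝔻_δ`. [folklore] -/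
def sawNeg (γ : DomainSAW unitDisk δ a b) : DomainSAW unitDisk δ (-a) (-b) :=
  ⟨γ.walk.map (negHom δ),
    (SimpleGraph.Walk.isPath_map_iff_of_injective negHom_injective).2 γ.isPath⟩

/-- The reflected walk read back with the endpoints `- -a = a`, `- -b = b`. [folklore] -/
def sawNeg' (γ' : DomainSAW unitDisk δ (-a) (-b)) : DomainSAW unitDisk δ a b :=
  ⟨(γ'.walk.map (negHom δ)).copy (neg_neg a) (neg_neg b),
    (SimpleGraph.Walk.isPath_copy _ _ _).2
      ((SimpleGraph.Walk.isPath_map_iff_of_injective negHom_injective).2 γ'.isPath)⟩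

/-- Support of the reflected walk. [folklore] -/
theorem support_sawNeg (γ : DomainSAW unitDisk δ a b) :
    (sawNeg γ).walk.support = γ.walk.support.map Neg.neg := by
  change (γ.walk.map (negHom δ)).support = _
  rw [SimpleGraph.Walk.support_map]
  rfl

/-- Support of `sawNeg'`. [folklore] -/
theorem support_sawNeg' (γ' : DomainSAW unitDisk δ (-a) (-b)) :
    (sawNeg' γ').walk.support = γ'.walk.support.map Neg.neg := by
  change ((γ'.walk.map (negHom δ)).copy _ _).support = _
  rw [SimpleGraph.Walk.support_copy, SimpleGraph.Walk.support_map]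
  rfl

/-- Length of the reflected walk. [folklore] -/
@[simp] theorem length_sawNeg (γ : DomainSAW unitDisk δ a b) : (sawNeg γ).length = γ.length :=
  SimpleGraph.Walk.length_map (negHom δ) γ.walk

/-- Reflecting a list of sites twice gives it back. [folklore] -/
theorem map_neg_map_neg (l : List (Site 2)) : (l.map Neg.neg).map Neg.neg = l := by
  rw [List.map_map, neg_comp_neg, List.map_id]

/-- A SAW of `Ω_δ` is determined by the list of its vertices. [folklore] -/
theorem domainSAW_eq_of_support_eq {Ω : Set ℂ} {γ₁ γ₂ : DomainSAW Ω δ a b}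
    (h : γ₁.walk.support = γ₂.walk.support) : γ₁ = γ₂ := by
  obtain ⟨p, hp⟩ := γ₁
  obtain ⟨q, hq⟩ := γ₂
  have hpq : p = q := SimpleGraph.Walk.support_injective h
  subst hpq
  rfl

/-- Central reflection as a bijection `SAW(𝔻_δ; a, b) ≃ SAW(𝔻_δ; -a, -b)`. [folklore] -/
def sawNegEquiv : DomainSAW unitDisk δ a b ≃ DomainSAW unitDisk δ (-a) (-b) where
  toFun := sawNeg
  invFun := sawNeg'
  left_inv γ := domainSAW_eq_of_support_eq (by rw [support_sawNeg', support_sawNeg, map_neg_map_neg])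
  right_inv γ' := domainSAW_eq_of_support_eq (by rw [support_sawNeg, support_sawNeg', map_neg_map_neg])

/-- The same, measurably (discrete σ-algebras). [folklore] -/
def sawNegMEquiv : DomainSAW unitDisk δ a b ≃ᵐ DomainSAW unitDisk δ (-a) (-b) where
  toEquiv := sawNegEquiv
  measurable_toFun := DomainSAW.measurable_of_top _
  measurable_invFun := DomainSAW.measurable_of_top _

/-- The underlying map of `sawNegEquiv` is `sawNeg`. [folklore] -/
@[simp] theorem coe_sawNegEquiv :
    ⇑(sawNegEquiv : DomainSAW unitDisk δ a b ≃ DomainSAW unitDisk δ (-a) (-b)) = sawNeg := rfl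

/-- The underlying map of `sawNegMEquiv` is `sawNeg`. [folklore] -/
@[simp] theorem coe_sawNegMEquiv :
    ⇑(sawNegMEquiv : DomainSAW unitDisk δ a b ≃ᵐ DomainSAW unitDisk δ (-a) (-b)) = sawNeg := rfl

/-- The central reflection of the plane as a continuous map. [folklore] -/
def negCM : C(ℂ, ℂ) := ⟨fun z => -z, continuous_neg⟩

/-- `negCM z = -z`. [folklore] -/
@[simp] theorem negCM_apply (z : ℂ) : negCM z = -z := rfl

/-- **The curve of the reflected walk is the reflected curve.** [folklore] -/
theorem curve_sawNeg (γ : DomainSAW unitDisk δ a b) : (sawNeg γ).curve = γ.curve.map negCM := by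
  change CurveClass.mk ⟨polyline ((sawNeg γ).walk.support.map (meshPoint δ))⟩ =
    (CurveClass.mk ⟨polyline (γ.walk.support.map (meshPoint δ))⟩).map negCM
  rw [CurveClass.map_mk, support_sawNeg, List.map_map]
  have hcomp : (meshPoint δ ∘ Neg.neg : Site 2 → ℂ) = (fun z : ℂ => -z) ∘ meshPoint δ :=
    funext fun v => meshPoint_neg δ v
  rw [hcomp, ← List.map_map]
  obtain ⟨l, hl⟩ : ∃ l, γ.walk.support = a :: l := ⟨γ.walk.support.tail, (γ.walk.cons_tail_support).symm⟩
  rw [hl, List.map_cons]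
  congr 1
  apply Curve.ext
  ext t
  change polyline ((meshPoint δ a :: l.map (meshPoint δ)).map fun z : ℂ => -z) t =
    -(polyline (meshPoint δ a :: l.map (meshPoint δ)) t)
  have h := Polyline.polyline_map_apply ((-LinearMap.id : ℂ →ₗ[ℝ] ℂ).toAffineMap)
    (meshPoint δ a) (l.map (meshPoint δ)) t
  have hf : ⇑((-LinearMap.id : ℂ →ₗ[ℝ] ℂ).toAffineMap) = fun z : ℂ => -z := by
    funext z
    simp
  rw [hf] at h
  simpa only [List.map_cons, List.map_map] using h

/-- **The weights `x^{|γ|}` of the disc are invariant under `z ↦ -z`.** [folklore] -/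
theorem weightAt_map_sawNeg (x : ℝ) (δ : ℝ) (a b : Site 2) :
    (weightAt x unitDisk δ a b).map sawNeg = weightAt x unitDisk δ (-a) (-b) := by
  ext s hs
  rw [Measure.map_apply (DomainSAW.measurable_of_top _) hs, weightAt_apply_tsum,
    weightAt_apply_tsum]
  have key : ∀ γ : DomainSAW unitDisk δ a b,
      (sawNeg ⁻¹' s).indicator (fun γ => ENNReal.ofReal (x ^ γ.length)) γ =
        s.indicator (fun γ' : DomainSAW unitDisk δ (-a) (-b) => ENNReal.ofReal (x ^ γ'.length))
          (sawNegEquiv γ) := by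
    intro γ
    by_cases h : sawNeg γ ∈ s
    · rw [indicator_of_mem (show γ ∈ sawNeg ⁻¹' s from h), coe_sawNegEquiv,
        indicator_of_mem h, length_sawNeg]
    · rw [indicator_of_notMem (show γ ∉ sawNeg ⁻¹' s from h), coe_sawNegEquiv,
        indicator_of_notMem h]
  rw [tsum_congr key]
  exact sawNegEquiv.tsum_eq fun γ' => s.indicator (fun γ' => ENNReal.ofReal (x ^ γ'.length)) γ'

/-- **The fugacity-`x` SAW of the disc is invariant in law under `z ↦ -z`**, at every `x`:
`(-)_* P_{(𝔻_δ,a,b,x)} = P_{(𝔻_δ,-a,-b,x)}`. [folklore] -/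
theorem lawAt_map_sawNeg (x : ℝ) (δ : ℝ) (a b : Site 2) :
    (lawAt x unitDisk δ a b).map sawNeg = lawAt x unitDisk δ (-a) (-b) := by
  have huniv : weightAt x unitDisk δ a b univ = weightAt x unitDisk δ (-a) (-b) univ := by
    rw [← weightAt_map_sawNeg x δ a b,
      Measure.map_apply (DomainSAW.measurable_of_top _) MeasurableSet.univ, preimage_univ]
  rw [lawAt, Measure.map_smul, weightAt_map_sawNeg, huniv, lawAt]

/-- Change of variables along the reflection. [folklore] -/
theorem integral_comp_sawNeg_lawAt (x : ℝ) (δ : ℝ) (a b : Site 2)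
    (g : DomainSAW unitDisk δ (-a) (-b) → ℝ) :
    ∫ γ, g (sawNeg γ) ∂lawAt x unitDisk δ a b = ∫ γ', g γ' ∂lawAt x unitDisk δ (-a) (-b) := by
  have h := integral_map_equiv (μ := lawAt x unitDisk δ a b) sawNegMEquiv g
  rw [coe_sawNegMEquiv, lawAt_map_sawNeg] at h
  exact h.symm

/-- **Reflected convergence.** If the curves of the fugacity-`x` SAW of `𝔻_δ` from `A δ` to `B δ`
converge in law to `Γ`, then those from `-A δ` to `-B δ` converge in law to `-Γ`. [folklore] -/
theorem tendstoLaw_neg_of_tendstoLaw {Ω' : Type*} [MeasurableSpace Ω'] {Γ : Ω' → CurveClass ℂ}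
    {W : Measure Ω'}
    (hT : TendstoLaw (fun δ (γ : DomainSAW unitDisk δ (A δ) (B δ)) => γ.curve)
      (fun δ => lawAt x unitDisk δ (A δ) (B δ)) Γ W) :
    TendstoLaw (fun δ (γ : DomainSAW unitDisk δ ((-A) δ) ((-B) δ)) => γ.curve)
      (fun δ => lawAt x unitDisk δ ((-A) δ) ((-B) δ)) (fun ω => (Γ ω).map negCM) W := by
  intro f
  have h := (hT.comp_continuous (CurveClass.continuous_map negCM)) f
  refine (tendsto_congr fun δ => ?_).1 h
  have hrw : (fun γ : DomainSAW unitDisk δ (A δ) (B δ) => f (γ.curve.map negCM)) =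
      fun γ => (fun γ' : DomainSAW unitDisk δ (-A δ) (-B δ) => f γ'.curve) (sawNeg γ) := by
    funext γ
    simp only [curve_sawNeg]
  simp only [hrw]
  exact integral_comp_sawNeg_lawAt x δ (A δ) (B δ) fun γ' => f γ'.curve

/-- The central reflection as a conformal automorphism of the unit disc. [folklore] -/
def negBall : ConformalEquiv (Metric.ball (0 : ℂ) 1) (Metric.ball (0 : ℂ) 1) where
  toFun z := -z
  invFun z := -z
  source := Metric.ball 0 1
  target := Metric.ball 0 1
  map_source' z hz := by simpa using hz
  map_target' z hz := by simpa using hz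
  left_inv' z _ := neg_neg z
  right_inv' z _ := neg_neg z
  source_eq := rfl
  target_eq := rfl
  differentiableOn := differentiable_id.neg.differentiableOn
  differentiableOn_symm := differentiable_id.neg.differentiableOn

/-- The marked points of `(𝔻; 1, -1)`. [folklore] -/
theorem unitDisc_pt_zero' : DobrushinDomain.unitDisc.pt 0 = 1 := by
  show circleMap 0 1 (2 * Real.pi * ((![0, 1 / 2] : Fin 2 → ℝ) 0)) = 1
  simp [circleMap]

/-- The marked points of `(𝔻; 1, -1)`. [folklore] -/
theorem unitDisc_pt_one' : DobrushinDomain.unitDisc.pt 1 = -1 := by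
  show circleMap 0 1 (2 * Real.pi * ((![0, 1 / 2] : Fin 2 → ℝ) 1)) = -1
  have h2 : (2 * Real.pi * ((![0, 1 / 2] : Fin 2 → ℝ) 1) : ℝ) = Real.pi := by
    simp only [Matrix.cons_val_one, Matrix.cons_val_fin_one]
    ring
  rw [h2]
  simp [circleMap, Complex.exp_pi_mul_I]

/-- **Chordal SLE_κ in `(𝔻; 1, -1)` reflected through the origin is chordal SLE_κ in
`(𝔻; -1, 1)`** (as random curves of the library: the uniformizing map composed with `z ↦ -z`).
Lawler (2005), §6.3. [cite: Lawler2005, §6.3] -/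
theorem isSLECurve_neg_unitDisc {Γ : (ℝ≥0 → ℝ) → CurveClass ℂ}
    (hΓ : IsSLECurve κ DobrushinDomain.unitDisc Γ) :
    IsSLECurve κ DobrushinDomain.unitDisc.swap (CurveClass.map negCM ∘ Γ) := by
  have hΦ : EqOn negCM (negBall : ℂ → ℂ) DobrushinDomain.unitDisc.carrier := fun z _ => rfl
  refine hΓ.map (D' := DobrushinDomain.unitDisc.swap) JordanDomain.exists_hasBoundaryValue_holds
    negBall ?_ ?_ hΦ
  · have h := negBall.hasBoundaryValue_of_eqOn hΦ (DobrushinDomain.unitDisc.pt 0)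
    rwa [MarkedDomain.pt_swap_zero, unitDisc_pt_one', show (-1 : ℂ) = negCM (DobrushinDomain.unitDisc.pt 0) by
      rw [negCM_apply, unitDisc_pt_zero']]
  · have h := negBall.hasBoundaryValue_of_eqOn hΦ (DobrushinDomain.unitDisc.pt 1)
    rwa [MarkedDomain.pt_swap_one, unitDisc_pt_zero', show (1 : ℂ) = negCM (DobrushinDomain.unitDisc.pt 1) by
      rw [negCM_apply, unitDisc_pt_one', neg_neg]]

/-- **One orientation gives the other, by symmetry.** Convergence of the fugacity-`x` SAW of
`(𝔻; 1, -1)` (endpoints `A δ → B δ`) to chordal SLE_κ implies convergence of the fugacity-`x` SAW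
of `(𝔻; -1, 1)` with the reflected endpoints `-A δ → -B δ` to chordal SLE_κ. [folklore] -/
theorem convergesInLawToSLE_neg_unitDisc
    (h : ConvergesInLawToSLE κ DobrushinDomain.unitDisc
        (fun δ (γ : DomainSAW DobrushinDomain.unitDisc.carrier δ (A δ) (B δ)) => γ.curve)
        (fun δ => lawAt x DobrushinDomain.unitDisc.carrier δ (A δ) (B δ))) :
    ConvergesInLawToSLE κ DobrushinDomain.unitDisc.swap
        (fun δ (γ : DomainSAW DobrushinDomain.unitDisc.carrier δ ((-A) δ) ((-B) δ)) => γ.curve)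
        (fun δ => lawAt x DobrushinDomain.unitDisc.carrier δ ((-A) δ) ((-B) δ)) := by
  obtain ⟨Γ, hΓ, -, hT⟩ := h
  exact ⟨_, isSLECurve_neg_unitDisc hΓ,
    Eventually.of_forall fun δ => (DomainSAW.measurable_of_top _).aemeasurable,
    tendstoLaw_neg_of_tendstoLaw hT⟩

/-- A closest site to `z` reflected is a closest site to `-z`. [folklore] -/
theorem IsClosestSite.neg {z : ℂ} {v : Site 2} (h : IsClosestSite unitDisk δ z v) :
    IsClosestSite unitDisk δ (-z) (-v) := by
  refine ⟨neg_mem_meshDomain_unitDisk_iff.2 h.1, fun w hw => ?_⟩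
  have h' := h.2 (-w) (neg_mem_meshDomain_unitDisk_iff.2 hw)
  rw [meshPoint_neg, dist_neg_neg]
  rwa [meshPoint_neg, dist_comm, dist_neg, dist_comm] at h'

/-- **Above `x_c`, an SLE_κ limit of the supercritical SAW of `(𝔻; 1, -1)` with SYMMETRIC
closest-site endpoints `a_δ = A δ`, `b_δ = -A δ` has `κ = 8` (modulo Miller–Sheffield):** the
second orientation required by `eq_eight_of_convergesInLawToSLE_unitDisc_swap` is supplied by the
symmetry `z ↦ -z` of `δℤ²` and of the disc (`convergesInLawToSLE_neg_unitDisc`).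
[cite: MillerSheffield2013, §1.2.4 (time-reversal of ordinary SLE_κ', κ' > 8)]
[cite: DuminilCopinKozmaYadin2014, Conjecture 11] -/
theorem eq_eight_of_convergesInLawToSLE_unitDisc_symm (hx : criticalFugacity < x) (h0 : 0 < κ)
    (hA : ∀ δ : ℝ, 0 < δ → IsClosestSite unitDisk δ 1 (A δ))
    (hNR : ∀ κ' : ℝ≥0, 8 < κ' → ∀ μ μ' : Measure (CurveClass ℂ),
      IsSLELaw κ' DobrushinDomain.unitDisc μ → IsSLELaw κ' DobrushinDomain.unitDisc.swap μ' →
        μ.map CurveClass.reverse ≠ μ')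
    (h : ConvergesInLawToSLE κ DobrushinDomain.unitDisc
        (fun δ (γ : DomainSAW DobrushinDomain.unitDisc.carrier δ (A δ) ((-A) δ)) => γ.curve)
        (fun δ => lawAt x DobrushinDomain.unitDisc.carrier δ (A δ) ((-A) δ))) :
    κ = 8 := by
  have hAB : ∀ δ : ℝ, 0 < δ →
      IsClosestSite unitDisk δ 1 (A δ) ∧ IsClosestSite unitDisk δ (-1) ((-A) δ) :=
    fun δ hδ => ⟨hA δ hδ, (hA δ hδ).neg⟩
  have h₂ := convergesInLawToSLE_neg_unitDisc h
  rw [neg_neg] at h₂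
  exact eq_eight_of_convergesInLawToSLE_unitDisc_swap hx h0 hAB hNR h h₂

end DiscSymmetry

end SupercriticalSAW

open SupercriticalSAW

/-! ### The audited barrier (eighth audit): reversibility pins `κ = 8` above `x_c` -/

/-- **Barrier `SupercriticalSAWSpaceFillingReversible`** (eighth audit of the mechanism of
`SupercriticalSAWSpaceFilling`; PROVED below, `SupercriticalSAWSpaceFillingReversible_holds`):
Theorem 1 of Duminil-Copin–Kozma–Yadin together with (a) the exact reversibility of the
fugacity-`x` self-avoiding walk at every `x` (`reverse_* P_{(Ω_δ,a,b,x)} = P_{(Ω_δ,b,a,x)}`),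
(b) its passage to limits — a two-orientation chordal SLE_κ description of the fugacity-`x` SAW
in a Dobrushin domain makes the SLE_κ law reversible (`reverse_* SLE_κ(D; a, b) = SLE_κ(D; b, a)`),
at every `x` and for every `κ` — and (c) the sharpened phase constraint in the unit disc: for
`x > 0`, `κ > 0`, closest-site endpoints and convergence to SLE_κ for both orientations of the
chord `[1, -1]`, `x = x_c` or (`x > x_c` and `κ = 8`), GIVEN that chordal SLE_κ', `κ' > 8`, is not
reversible in the disc (Miller–Sheffield 2017 — an explicit hypothesis, not a named fact).

BARRIER (structured block, D-0021):
- technique_class: that of `SupercriticalSAWSpaceFilling` / `…Phases` (fugacity-robust, δ-uniform conclusions identifying the curve-topology limit of the fugacity-`x` SAW with a chordal SLE_κ), refined on the `κ`-axis above `x_c` by a fugacity-BLIND filter: any candidate description of a phase of the fugacity-`x` SAW, asserted for both orientations of the marked points (as every instance of a universally quantified statement `∀ D, ∀ endpoint approximations` is), by a law that is NOT time-reversal symmetric — chordal SLE_κ' with `κ' > 8`, or SLE_κ'(ρ₁;ρ₂), `κ' ∈ (4, 8)`, with some `ρᵢ < κ'/2 − 4` [cite: MillerSheffield2013, §1.2.4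 (time-reversal of ordinary SLE_κ', κ' > 8)] — is excluded at every `x`, because the weights `x^{|γ|}` are reversal invariant [cite: LawlerSchrammWerner2004SAW, §3.1]
- blocks: everything the base barrier and `…Phases` block, and (proved here): `SupercriticalSAW.lawAt_map_sawReverse` (exact reversibility of `P_{(Ω_δ,a,b,x)}` for all `x, Ω, δ, a, b`); `SupercriticalSAW.map_reverse_eq_of_convergesInLawToSLE_swap` (convergence to SLE_κ in `(D; a, b)` and in `(D; b, a)` ⇒ `reverse_* SLE_κ(D; a, b) = SLE_κ(D; b, a)`), `SupercriticalSAW.not_convergesInLawToSLE_swap_of_not_reversible` (a non-reversible SLE_κ describes no phase for both orientations); `SupercriticalSAW.map_reverse_eq_of_sawScalingLimit` (the sub-problem `SAWScalingLimit` IMPLIES the reversibility of chordal SLE_{8/3} in every Dobrushin domain with an endpoint approximation — Zhan's theorem [cite: Zhan2008Reversibility, main theorem] as a consequence; disc instance `SupercriticalSAW.map_reverse_eq_unitDisc_of_sawScalingLimit`); `SupercriticalSAW.eq_eight_of_convergesInLawToSLE_unitDisc_swap` and `SupercriticalSAW.eq_criticalFugacity_or_eq_eight_of_convergesInLawToSLE_unitDisc_swap`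 (for `x > x_c` a two-orientation SLE_κ limit of the closest-site SAW of the disc has `κ = 8`, and the phase constraint reads `x = x_c ∨ (x_c < x ∧ κ = 8)`, under the hypothesis `hNR` = non-reversibility of chordal SLE_κ', `κ' > 8`, in the disc) [cite: DuminilCopinKozmaYadin2014, Theorem 1 and §4]
- because: reversal `γ ↦ γ^R` is a length-preserving bijection `SAW(Ω_δ; a, b) → SAW(Ω_δ; b, a)`, so it preserves `x^{|γ|}` and the partition function, and the polyline of `γ^R` is the time-reversed polyline (`Polyline.reverse_mk_polyline`); reversal is an isometry of the curve space, so `γ_δ → Γ` in law gives `γ_δ^R → Γ^R`, limits in law are unique (bounded continuous functions separate finite Borel measures [cite: Billingsley1999, Thm 1.2]) and the SLE_κ law of a Dobrushin domain is unique (`IsSLELaw.unique'`, proved); above `x_c`, `κ ≥ 8` by Theorem 1 and Rohde–Schramm's Cor. 7.4 (`…Phases`) [cite: RohdeSchramm2005, Cor. 7.4], and "When `κ' > 8`, ordinary SLE_κ'(ρ₁;ρ₂) has time-reversal symmetry if and only if `ρ₁ = ρ₂ = κ'/4 − 2`", "The time-reversal of an ordinary SLE_κ' process for `κ' > 8` is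 not itself an SLE_κ' process" [cite: MillerSheffield2013, §1.2.4 (time-reversal of ordinary SLE_κ', κ' > 8)]
- evasions_known: those of the catalogue, with evasion (vii) ("SLE_κ for some `κ(x)` on `[x_c, x_c + ε)`", admissible `κ(x) ≥ 8` for `x > x_c` since gen 6) narrowed to `κ(x) = 8` for `x > x_c` modulo [cite: MillerSheffield2013, §1.2.4 (time-reversal of ordinary SLE_κ', κ' > 8)] — i.e. to the SLE₈ of §4 of the source [cite: DuminilCopinKozmaYadin2014, §4 (the case x > 1/μ)]; reversibility constrains nothing AT `x_c` beyond "the limit is reversible" (chordal SLE_κ is reversible for all `κ ≤ 8` [cite: Zhan2008Reversibility, main theorem] [cite: MillerSheffield2013, abstract]); NOT obstructed and recorded for planners: (xiii) topological SIDE observables at a fixed interior point — Schramm's left-passage probability [cite: Schramm2001Percolation, Theorem 1], first hits of interior crosscuts, windings about `z` — are discontinuous functionals at every curve through `z`, and onto limits pass through `z` a.s., so neither Theorem 1 nor an SLE₈ limit determines `lim P_{x,δ}[z left of γ_δ]` above `x_c`; right-robust (`[x_c, x_c + ε)`) Schramm-type conclusions are certified false at no `x > x_c` by the source ("We know that the curve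 becomes space-filling, yet we have very little additional information" [cite: DuminilCopinKozmaYadin2014, §4 (before Problem 9)]) or the tree, while their two-sided versions die in substance on the subcritical geodesic picture (sides of `z ∉ [a, b]` become deterministic), proved in the tree only as `|γ_δ| = O(1/δ)`, which does not pin sides
- scope_caveats: those of the earlier audits; the `κ = 8` sharpening carries the explicit hypothesis `hNR` (non-reversibility of chordal SLE_κ', `κ' > 8`, in the disc, in the form `reverse_* SLE_κ'(𝔻; 1, -1) ≠ SLE_κ'(𝔻; -1, 1)`), which is Miller–Sheffield's printed theorem read through conformal invariance and the reflection symmetry of `√κ B` (their symmetry is stated with an anti-conformal automorphism swapping the endpoints) — the tree contains no proof of it [cite: MillerSheffield2013, §1.2.4 (time-reversal of ordinary SLE_κ', κ' > 8)]; it needs convergence for BOTH orientations `(𝔻; 1, -1)`, `(𝔻; -1, 1)` (automatic for `SAWScalingLimitAt x`-type universals; for the disc the second is the image of the first under the symmetry `z ↦ -z` of `δℤ²`, `SupercriticalSAW.convergesInLawToSLE_neg_unitDisc`, so one convergence statement with symmetric closest-site endpoints `b_δ = -a_δ` suffices, `SupercriticalSAW.eq_eight_of_convergesInLawToSLE_unitDisc_symm`);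 at `x = x_c` every reversible candidate survives (all `κ ≤ 8`); convergence of the supercritical walk to anything has no proof in print [cite: DuminilCopinKozmaYadin2014, §4 (the case x > 1/μ)]; item (xiii) is a remark on the reach of the mechanism, makes no assertion that Schramm's formula holds at any `x ≠ x_c`
- status: established (proved in the tree: `SupercriticalSAWSpaceFillingReversible_holds`, axioms `propext`, `Classical.choice`, `Quot.sound`); audit gen 8 of `…Proofs` 2026-08-16: CONFIRMED at page level [cite: DuminilCopinKozmaYadin2014, Theorem 1] [cite: DuminilCopinKozmaYadin2014, §4 (the case x > 1/μ)] and STRENGTHENED — the recorded open point "`κ = 8` versus `κ > 8` above `x_c`" is decided modulo [cite: MillerSheffield2013, §1.2.4 (time-reversal of ordinary SLE_κ', κ' > 8)]; 27 citing works of the source re-listed (newest Ann. Probab. 2026, arXiv:2310.17299), none evading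

[cite: DuminilCopinKozmaYadin2014, Theorem 1 and §4] -/
def SupercriticalSAWSpaceFillingReversible : Prop :=
  SupercriticalSAWSpaceFilling ∧
    (∀ (x : ℝ) (Ω : Set ℂ) (δ : ℝ) (a b : Site 2),
      (lawAt x Ω δ a b).map sawReverse = lawAt x Ω δ b a) ∧
    (∀ (κ : ℝ≥0) (D : DobrushinDomain) (x : ℝ) (A B : ℝ → Site 2),
      ConvergesInLawToSLE κ D (fun δ (γ : DomainSAW D.carrier δ (A δ) (B δ)) => γ.curve)
          (fun δ => lawAt x D.carrier δ (A δ) (B δ)) →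
        ConvergesInLawToSLE κ D.swap (fun δ (γ : DomainSAW D.carrier δ (B δ) (A δ)) => γ.curve)
            (fun δ => lawAt x D.carrier δ (B δ) (A δ)) →
          ∀ μ μ' : Measure (CurveClass ℂ), IsSLELaw κ D μ → IsSLELaw κ D.swap μ' →
            μ.map CurveClass.reverse = μ') ∧
    (∀ (x : ℝ), 0 < x → ∀ (κ : ℝ≥0), 0 < κ → ∀ A B : ℝ → Site 2,
      (∀ δ : ℝ, 0 < δ → IsClosestSite unitDisk δ 1 (A δ) ∧ IsClosestSite unitDisk δ (-1) (B δ)) →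
        (∀ κ' : ℝ≥0, 8 < κ' → ∀ μ μ' : Measure (CurveClass ℂ),
          IsSLELaw κ' DobrushinDomain.unitDisc μ → IsSLELaw κ' DobrushinDomain.unitDisc.swap μ' →
            μ.map CurveClass.reverse ≠ μ') →
        ConvergesInLawToSLE κ DobrushinDomain.unitDisc
            (fun δ (γ : DomainSAW DobrushinDomain.unitDisc.carrier δ (A δ) (B δ)) => γ.curve)
            (fun δ => lawAt x DobrushinDomain.unitDisc.carrier δ (A δ) (B δ)) →
          ConvergesInLawToSLE κ DobrushinDomain.unitDisc.swap
              (fun δ (γ : DomainSAW DobrushinDomain.unitDisc.carrier δ (B δ) (A δ)) => γ.curve)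
              (fun δ => lawAt x DobrushinDomain.unitDisc.carrier δ (B δ) (A δ)) →
            x = criticalFugacity ∨ (criticalFugacity < x ∧ κ = 8))

/-- **The audited barrier holds**: Theorem 1 is `SupercriticalSAWSpaceFilling_holds`
(`…TilesTheorem6`), clause (a) is `lawAt_map_sawReverse`, clause (b) is
`map_reverse_eq_of_convergesInLawToSLE_swap`, clause (c) is
`eq_criticalFugacity_or_eq_eight_of_convergesInLawToSLE_unitDisc_swap`.
[cite: DuminilCopinKozmaYadin2014, Theorem 1 and §4] -/
theorem SupercriticalSAWSpaceFillingReversible_holds : SupercriticalSAWSpaceFillingReversible :=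
  ⟨SupercriticalSAWSpaceFilling_holds,
    lawAt_map_sawReverse,
    fun _ _ _ _ _ h₁ h₂ _ _ hμ hμ' => map_reverse_eq_of_convergesInLawToSLE_swap h₁ h₂ hμ hμ',
    fun _ hx0 _ h0 _ _ hAB hNR h₁ h₂ =>
      eq_criticalFugacity_or_eq_eight_of_convergesInLawToSLE_unitDisc_swap hx0 h0 hAB hNR h₁ h₂⟩

end Literature.Barriers.CriticalPhenomena
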